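import Literature.AlgebraicGeometry.Frobenioids.ArchimedeanTheoremsInstances
import Literature.AlgebraicGeometry.Frobenioids.ArchimedeanDivisorMaximality
import HarnessLib

/-!
# Frobenioids II, Theorem 3.6 (iii), the factorization `φ = β ∘ α` — PROVED for `C = C₀ ×_{D₀} D`

Mochizuki, *The geometry of Frobenioids II*, Kyushu J. Math. **62** (2008) 401–460, §3, Theorem 3.6
(iii), author's kurims text p. 37 [cite: MochizukiFrdII2008, Thm 3.6 (iii) p.37]:

> "(iii) Every morphism `φ : B → A` of `C` factors uniquely as a composite `φ = β ∘ α`, where `α` is an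
> isometry [hence belongs to `A`], and `β ∈ O^▷(A) ⊆ Φ^fld(A)` belongs to the submonoid
> `Φ^gp(A) × {1} ⊆ Φ^fld(A)` […]"

(proof, p. 39: "The existence and uniqueness of the factorization asserted in the statement of assertion
(iii) follows immediately from the construction of `C`"). This file DISCHARGES the instance
`ArchFrd.Thm36iii_factorization_C` of `ArchimedeanTheoremsInstances.lean` (the generic predicate
`Thm36iii_factorization` of `ArchimedeanBasicProperties.lean` at the archimedean Frobenioid `C π` of
Example 3.3 over any base `π : D → D₀`, with "belongs to `Φ^gp(A) × {1}`" rendered as "radial": positive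
real scalar): for `φ : B → A` with `C₀`-component `(b, d, c)` and ratio
`t = tip(A)/(|c|·tip(B)^d) ≥ 1`, the isometric part is `α = (b, d, c·t)` (over the same arrow of `D`) and
the radial part is `β = (id, 1, 1/t)` (over the identity); uniqueness because an isometry has ratio `1`
and a radial base-identity endomorphism is determined by its positive real scalar.
The remaining clause of (iii) (the equivalence `C ⥲ A ×_{A^istr} C^istr`) is not treated here.
No statement of the paper is strengthened.
-/

namespace Literature.AlgebraicGeometry.Frobenioids

open CategoryTheory
open scoped Pointwise

universe v u

namespace ArchFrd

/-! ### `C₀`-level helper (positive real scalars; `unitPart_ofPosReal_mul`, `norm_le_of_mem_carrier_pow`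
are abc-iut-L1-t6's, `ArchimedeanDivisorMaximality.lean`) -/

namespace C0

variable {X Y : C0}

/-- `‖r‖ = r` for a positive real scalar read in `ℂ`. [cite: MochizukiFrdII2008, Def 3.1 (ii) p.24] -/
theorem norm_coe_ofPosReal (r : PosReal) : ‖((ofPosReal ℂ r : ℂˣ) : ℂ)‖ = (r : ℝ) := by
  rw [coe_ofPosReal, RCLike.norm_ofReal, abs_of_pos r.2]

/-- The positive real number `t = ratio(φ)` as an element of `ℝ_{>0}`. [cite: MochizukiFrdII2008, Ex 3.3 (i) p.28] -/
noncomputable def ratioPos (φ : X ⟶ Y) : PosReal := ⟨ratio φ, ratio_pos φ⟩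

/-- The RADIAL PART of `φ : X → Y`: the endomorphism `(id, 1, 1/ratio(φ))` of `Y` (Thm. 3.6 (iii): the
factor `β ∈ O^▷(A)` in `Φ^gp(A) × {1}`). [cite: MochizukiFrdII2008, Thm 3.6 (iii) p.37] -/
noncomputable def radialPart (φ : X ⟶ Y) : Y ⟶ Y where
  base := 𝟙 Y.base
  degFr := 1
  scalar := ofPosReal ℂ (ratioPos φ)⁻¹
  scalar_mem := ofPosReal_mem_scalars _ _
  mapsTo := by
    rw [PNat.one_coe, pow_one, pullRegion_id]
    rintro _ ⟨u, hu, rfl⟩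
    refine ⟨?_, ?_⟩
    · change unitPart ℂ (ofPosReal ℂ (ratioPos φ)⁻¹ * u) ∈ Y.region.dir
      rw [unitPart_ofPosReal_mul]; exact hu.1
    · have hu2 : ‖(u : ℂ)‖ ≤ Y.tip := by
        have := hu.2
        rw [← Subtype.coe_le_coe, coe_absHom] at this
        exact this
      change absHom ℂ (ofPosReal ℂ (ratioPos φ)⁻¹ * u) ≤ Y.region.tip
      rw [← Subtype.coe_le_coe, coe_absHom, Units.val_mul, norm_mul, norm_coe_ofPosReal,
        Positive.coe_inv]
      have h1 : ((ratioPos φ : PosReal) : ℝ)⁻¹ ≤ 1 := inv_le_one_of_one_le₀ (one_le_ratio φ)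
      calc ((ratioPos φ : PosReal) : ℝ)⁻¹ * ‖(u : ℂ)‖ ≤ 1 * ‖(u : ℂ)‖ := by gcongr
        _ = ‖(u : ℂ)‖ := one_mul _
        _ ≤ Y.tip := hu2

/-- The ISOMETRIC PART of `φ = (b, d, c) : X → Y`: `(b, d, c · ratio(φ))` (Thm. 3.6 (iii): the factor
`α`, an isometry). [cite: MochizukiFrdII2008, Thm 3.6 (iii) p.37] -/
noncomputable def isometricPart (φ : X ⟶ Y) : X ⟶ Y where
  base := Base φ
  degFr := degFr φ
  scalar := scalar φ * ofPosReal ℂ (ratioPos φ)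
  scalar_mem := mul_mem (Hom.scalar_mem φ) (ofPosReal_mem_scalars _ _)
  mapsTo := by
    rintro _ ⟨v, hv, rfl⟩
    obtain ⟨y, hy, hyeq⟩ := (Hom.mapsTo φ) (Set.smul_mem_smul_set hv)
    have hv' : ‖(v : ℂ)‖ ≤ (X.tip : ℝ) ^ (degFr φ : ℕ) := norm_le_of_mem_carrier_pow _ _ _ hv
    have habs_y : ‖(y : ℂ)‖ = ‖(scalar φ : ℂ)‖ * ‖(v : ℂ)‖ := by
      have h := congrArg (fun u : ℂˣ => ‖(u : ℂ)‖) hyeq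
      simp only [smul_eq_mul, Units.val_mul, norm_mul] at h
      rw [← h]
      exact (D0.norm_galAct _ _).symm
    refine ⟨ofPosReal ℂ (ratioPos φ) * y, ⟨?_, ?_⟩, ?_⟩
    · rw [unitPart_ofPosReal_mul]; exact hy.1
    · rw [← Subtype.coe_le_coe, coe_absHom, Units.val_mul, norm_mul, norm_coe_ofPosReal, habs_y]
      change ratio φ * (‖(scalar φ : ℂ)‖ * ‖(v : ℂ)‖) ≤ Y.tip
      calc ratio φ * (‖(scalar φ : ℂ)‖ * ‖(v : ℂ)‖)
          ≤ ratio φ * (‖(scalar φ : ℂ)‖ * (X.tip : ℝ) ^ (degFr φ : ℕ)) := by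
            gcongr; exact (ratio_pos φ).le
        _ = Y.tip := by
            unfold ratio
            exact div_mul_cancel₀ _
              (mul_pos (norm_pos_iff.mpr (scalar φ).ne_zero) (pow_pos X.tip_pos _)).ne'
    · change (Base φ).act (ofPosReal ℂ (ratioPos φ) * y) = (scalar φ * ofPosReal ℂ (ratioPos φ)) • v
      rw [map_mul, hyeq, smul_eq_mul, smul_eq_mul]
      change D0.galAct _ (ofPosReal ℂ (ratioPos φ)) * (scalar φ * v) = scalar φ * ofPosReal ℂ _ * v
      rw [D0.galAct_eq_self_of_mem_scalars_real _ (ofPosReal_mem_scalars _ .real), mul_left_comm,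
        mul_assoc]

/-- The isometric part is an isometry: `|c · t| · tip(B)^d = tip(A)`. [cite: MochizukiFrdII2008, Thm 3.6 (iii) p.37] -/
theorem isIsometry_isometricPart (φ : X ⟶ Y) :
    PreFrobenioid.IsIsometry C0.toElem (isometricPart φ) := by
  rw [A0.isIsometry_iff_norm_mul_tip_pow]
  change ‖((scalar φ * ofPosReal ℂ (ratioPos φ) : ℂˣ) : ℂ)‖ * X.tip ^ (degFr φ : ℕ) = Y.tip
  rw [Units.val_mul, norm_mul, norm_coe_ofPosReal]
  change ‖(scalar φ : ℂ)‖ * ratio φ * X.tip ^ (degFr φ : ℕ) = Y.tip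
  rw [mul_right_comm]
  unfold ratio
  exact mul_div_cancel₀ _ (mul_pos (norm_pos_iff.mpr (scalar φ).ne_zero) (pow_pos X.tip_pos _)).ne'

/-- `α ≫ β = φ`. [cite: MochizukiFrdII2008, Thm 3.6 (iii) p.37] -/
theorem isometricPart_comp_radialPart (φ : X ⟶ Y) : isometricPart φ ≫ radialPart φ = φ := by
  refine hom_ext ?_ ?_ ?_
  · exact Category.comp_id _
  · exact mul_one _
  · rw [scalar_comp']
    change (Base φ).act (ofPosReal ℂ (ratioPos φ)⁻¹) *
        (scalar φ * ofPosReal ℂ (ratioPos φ)) ^ ((1 : ℕ+) : ℕ) = scalar φ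
    change D0.galAct _ (ofPosReal ℂ (ratioPos φ)⁻¹) * _ = _
    rw [D0.galAct_eq_self_of_mem_scalars_real _ (ofPosReal_mem_scalars _ .real), PNat.one_coe, pow_one,
      map_inv, mul_left_comm, inv_mul_cancel, mul_one]

/-- A radial base-identity endomorphism of Frobenius degree `1` post-composed with an isometry recovers
both factors: uniqueness at the level of `C₀`. [cite: MochizukiFrdII2008, Thm 3.6 (iii) p.37] -/
theorem eq_parts_of_factorization {φ α : X ⟶ Y} {β : Y ⟶ Y}
    (hα : PreFrobenioid.IsIsometry C0.toElem α) (hβb : Base β = 𝟙 Y.base) (hβd : degFr β = 1)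
    (hβim : ((scalar β : ℂˣ) : ℂ).im = 0) (hβre : 0 < ((scalar β : ℂˣ) : ℂ).re) (h : α ≫ β = φ) :
    α = isometricPart φ ∧ β = radialPart φ := by
  -- the radial scalar as a positive real
  set r : PosReal := ⟨((scalar β : ℂˣ) : ℂ).re, hβre⟩ with hr
  have hc : scalar β = ofPosReal ℂ r := Units.ext (Complex.ext (by simp [hr]) (by simp [hβim]))
  -- components of `φ` in terms of `α`, `β`
  have hbase : Base α = Base φ := by rw [← h, base_comp', hβb, Category.comp_id]
  have hdeg : degFr α = degFr φ := by rw [← h, degFr_comp', hβd, mul_one]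
  have hsc : ofPosReal ℂ r * scalar α = scalar φ := by
    rw [← h, scalar_comp', hc, hβd, PNat.one_coe, pow_one]
    change _ = D0.galAct _ (ofPosReal ℂ r) * scalar α
    rw [D0.galAct_eq_self_of_mem_scalars_real _ (ofPosReal_mem_scalars _ .real)]
  -- the isometry condition pins down `r`
  have hiso := (A0.isIsometry_iff_norm_mul_tip_pow α).mp hα
  rw [hdeg] at hiso
  have hsα : ‖(scalar α : ℂ)‖ = ((r : ℝ))⁻¹ * ‖(scalar φ : ℂ)‖ := by
    have := congrArg (fun u : ℂˣ => ‖(u : ℂ)‖) hsc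
    simp only [Units.val_mul, norm_mul, norm_coe_ofPosReal] at this
    rw [← this, ← mul_assoc, inv_mul_cancel₀ r.2.ne', one_mul]
  have hr_eq : r = (ratioPos φ)⁻¹ := by
    apply Subtype.ext
    rw [Positive.coe_inv]
    change (r : ℝ) = (ratio φ)⁻¹
    unfold ratio
    rw [inv_div]
    have hspos : 0 < ‖(scalar φ : ℂ)‖ * X.tip ^ (degFr φ : ℕ) :=
      mul_pos (norm_pos_iff.mpr (scalar φ).ne_zero) (pow_pos X.tip_pos _)
    rw [hsα, mul_assoc] at hiso
    -- hiso : r⁻¹ * (‖c‖ * tip^d) = tip_Y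
    rw [eq_div_iff Y.tip_pos.ne', ← hiso, ← mul_assoc, mul_inv_cancel₀ r.2.ne', one_mul]
  refine ⟨hom_ext hbase hdeg ?_, hom_ext hβb hβd ?_⟩
  · change scalar α = scalar φ * ofPosReal ℂ (ratioPos φ)
    rw [← hsc, hr_eq, map_inv, mul_comm, ← mul_assoc, mul_inv_cancel, one_mul]
  · change scalar β = ofPosReal ℂ (ratioPos φ)⁻¹
    rw [hc, hr_eq]

end C0

/-! ### Theorem 3.6 (iii), factorization, for `C = C₀ ×_{D₀} D` -/

variable {D : Type u} [Category.{v} D] (π : D ⥤ D0)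

/-- The isometric part of an arrow of `C`, over the same arrow of `D`. [cite: MochizukiFrdII2008, Thm 3.6 (iii) p.37] -/
noncomputable def isometricPart {B A : C π} (φ : B ⟶ A) : B ⟶ A where
  fst := C0.isometricPart φ.fst
  snd := φ.snd
  w := φ.w

/-- The radial part of an arrow of `C`, over the identity of `D`. [cite: MochizukiFrdII2008, Thm 3.6 (iii) p.37] -/
noncomputable def radialPart {B A : C π} (φ : B ⟶ A) : A ⟶ A where
  fst := C0.radialPart φ.fst
  snd := 𝟙 A.snd
  w := by
    change 𝟙 _ ≫ A.iso.hom = A.iso.hom ≫ π.map (𝟙 A.snd)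
    rw [CategoryTheory.Functor.map_id, Category.id_comp, Category.comp_id]

/-- **Theorem 3.6 (iii), factorization, for `C`** (PROVED): every `φ : B → A` of `C = C₀ ×_{D₀} D` factors
uniquely as an isometry followed by a radial element of `O^▷(A)`.
[cite: MochizukiFrdII2008, Thm 3.6 (iii) p.37] -/
theorem thm36iii_factorization_C : Thm36iii_factorization_C π := by
  intro B A φ
  refine ⟨(isometricPart π φ, radialPart π φ), ⟨?_, ⟨rfl, rfl⟩, ?_, ?_⟩, ?_⟩
  · change pull Φ₀ B.iso.inv (PreFrobenioid.Div C0.toElem (C0.isometricPart φ.fst)) = 1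
    rw [C0.isIsometry_isometricPart]
    exact map_one _
  · change ((ofPosReal ℂ (C0.ratioPos φ.fst)⁻¹ : ℂˣ) : ℂ).im = 0 ∧
      0 < ((ofPosReal ℂ (C0.ratioPos φ.fst)⁻¹ : ℂˣ) : ℂ).re
    rw [coe_ofPosReal]
    exact ⟨Complex.ofReal_im _, ((C0.ratioPos φ.fst)⁻¹).2⟩
  · exact CFP.hom_ext (C0.isometricPart_comp_radialPart φ.fst) (Category.comp_id _)
  · rintro ⟨α, β⟩ ⟨hα, ⟨hβb, hβd⟩, ⟨hβim, hβre⟩, hcomp⟩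
    -- unpack the hypotheses to the components
    have hβsnd : β.snd = 𝟙 A.snd := hβb
    have hβbase : C0.Base β.fst = 𝟙 A.fst.base := by
      have hw := β.w
      rw [hβsnd, CategoryTheory.Functor.map_id, Category.comp_id] at hw
      exact (cancel_mono A.iso.hom).mp (hw.trans (Category.id_comp _).symm)
    have hαiso : PreFrobenioid.IsIsometry C0.toElem α.fst := hα
    have hfst : α.fst ≫ β.fst = φ.fst := congrArg CFP.Hom.fst hcomp
    have hsnd : α.snd = φ.snd := by
      have := congrArg CFP.Hom.snd hcomp
      rw [CFP.comp_snd, hβsnd, Category.comp_id] at this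
      exact this
    obtain ⟨h1, h2⟩ := C0.eq_parts_of_factorization hαiso hβbase hβd hβim hβre hfst
    exact Prod.ext (CFP.hom_ext h1 hsnd) (CFP.hom_ext h2 hβsnd)

/-- `Thm36iii_factorization_C π` — Thm. 3.6 (iii), the factorization `φ = β ∘ α` (isometry, then radial element) for `C` over any base `π` — holds: the named-fact instance of `ArchimedeanTheoremsInstances.lean` is
the theorem `thm36iii_factorization_C` just proved; this alias records the discharge under the tree's exact naming
convention `X_holds` (D-0026 bookkeeping, flt-inv gen 65: proof term = the existing theorem; nothing else
edited; the ledger listed the fact as unproved, `ledger fact claim` GRANTED 2026-08-28T09:4xZ). [cite: MochizukiFrdII2008, Thm 3.6 (iii) p.37] -/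
theorem Thm36iii_factorization_C_holds : Thm36iii_factorization_C π := thm36iii_factorization_C π

end ArchFrd

end Literature.AlgebraicGeometry.Frobenioids
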